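import Summits.AtomisticToContinuum.HydrodynamicLimit.Theorems.LambertianContactSwapContactAngleEquidistributionBoostAlexander
import Summits.AtomisticToContinuum.HydrodynamicLimit.Theorems.LambertianContactSwapContactAngleEquidistributionBoostInstants
import Summits.AtomisticToContinuum.HydrodynamicLimit.Theorems.AntiMazurCoboundariesKineticWindowGronwallBoostGibbs
import Literature.MathematicalPhysics.KineticTheory.HardSphereEulerProofs
import Mathlib.Probability.Distributions.Gaussian.Basic
import HarnessLib

/-!
# Galilean covariance of the crux functional (line `Sketch` v7, crux
# `LambertianContactSwap.ContactAngleEquidistribution`, stmt-AtomisticToContinuum-12097; lead c4)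

Helper file (`--supports stmt-AtomisticToContinuum-12097`, registered stub `stub_cruxFunctionalVelShift`).
The crux functional of `ContactAngleEquidistribution` — the normalised `|g|²`-weighted collision sum of
`κ_g`-centred admissible marks `ψ_N(s, x_mid, v_i, v_j, ω)` over Alexander's collision-by-collision construction —
is COVARIANT under the Galilean boost: read on the velocity-translated datum `velShift u z = (x_i, v_i + u)_i` it
equals the functional, read on `z`, of the boosted test function `ψ^u(s, x, v, w, n) = ψ(s, x + s u, v + u, w + u, n)`
(`cruxFunctional_velShift`). Ingredients: the boost covariance of Alexander's construction
(`…BoostAlexander`: exit times, instants and counts are invariant, the `m`-th pre-collisional configuration of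
the boosted datum is the boost AT THE COLLISION INSTANT of the `m`-th pre-collisional configuration of the
datum — `…BoostInstants` identifies the accumulated real exit times with the instant of every counted
collision), and the kinematics of one summand (`cruxSummand_boostAt`: contact, incoming, relative velocity and
contact normal are boost-invariant, the contact midpoint moves by `s u`).

References (folklore: Galilean invariance of Newtonian hard-sphere dynamics): C. Cercignani, R. Illner,
M. Pulvirenti, *The Mathematical Theory of Dilute Gases* (1994), §4.2; I. Gallagher, L. Saint-Raymond,
B. Texier, *From Newton to Boltzmann* (2013), §1.1.
-/

noncomputable section

open MeasureTheory Filter Set Topology ProbabilityTheory Function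
open scoped ENNReal BigOperators Classical RealInnerProductSpace

namespace Summit.AtomisticToContinuum.HydrodynamicLimit.Theorems.ContactAngleEquidistributionSketch

open Literature.Analysis Literature.Analysis.FluidPDE Literature.MathematicalPhysics.KineticTheory
open Summit.AtomisticToContinuum.HydrodynamicLimit.Theorems.KineticWindowGronwallBoost

/-- `velShift u` is the Galilean boost at time `0`. [folklore] -/
theorem velShift_eq_boostAt {n : ℕ} (u : V3) (z : Config n (Fin 3) T3) : velShift u z = boostAt u 0 z := by
  funext i
  simp

/-- The contact midpoint of a pair moves with the boost: `x_mid(boostAt u s y) = x_mid(y) + proj (s • u)`.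
[folklore] -/
theorem xmid_boostAt {n : ℕ} (u : V3) (s : ℝ) (y : Config n (Fin 3) T3) (i j : Fin n) :
    (Torus.geometry (Fin 3)).translate (boostAt u s y j).1
        ((2 : ℝ)⁻¹ • (Torus.geometry (Fin 3)).sepVec (boostAt u s y i).1 (boostAt u s y j).1) =
      (Torus.geometry (Fin 3)).translate (y j).1 ((2 : ℝ)⁻¹ • (Torus.geometry (Fin 3)).sepVec (y i).1 (y j).1) +
        FunctionSpaces.Torus.proj (s • u) := by
  rw [sepVec_boostAt, boostAt_apply_fst, Torus.geometry_translate, Torus.geometry_translate, add_right_comm]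

/-- **One summand of the crux functional is boost-covariant**: for a configuration boosted AT THE INSTANT `s`
at which the mark is read, the `κ_g`-centred `|g|²`-weighted contact-angle summand of `ψ` equals the summand of
the boosted test function `ψ^u(s, x, v, w, n) = ψ(s, x + s u, v + u, w + u, n)` on the unboosted configuration
(contact set, incoming condition, relative velocity and contact normal are boost-invariant; the midpoint moves
by `s u`, the two velocities by `u`). [folklore] -/
theorem cruxSummand_boostAt {N : ℕ} (ψ : ℕ → ℝ → T3 → V3 → V3 → V3 → ℝ) (u : V3) (e s : ℝ)
    (y : Config (N + 1) (Fin 3) T3) (i j : Fin (N + 1)) :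
    (if i < j ∧ boostAt u s y ∈ contactSet (Torus.geometry (Fin 3)) (N + 1) e i j ∧
          IsIncoming (Torus.geometry (Fin 3)) (boostAt u s y) i j then
        ‖(boostAt u s y i).2 - (boostAt u s y j).2‖ ^ 2 *
          (ψ N s ((Torus.geometry (Fin 3)).translate (boostAt u s y j).1
                ((2 : ℝ)⁻¹ • (Torus.geometry (Fin 3)).sepVec (boostAt u s y i).1 (boostAt u s y j).1))
              (boostAt u s y i).2 (boostAt u s y j).2
              (e⁻¹ • (Torus.geometry (Fin 3)).sepVec (boostAt u s y i).1 (boostAt u s y j).1) -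
            ∫ ξ, ψ N s ((Torus.geometry (Fin 3)).translate (boostAt u s y j).1
                ((2 : ℝ)⁻¹ • (Torus.geometry (Fin 3)).sepVec (boostAt u s y i).1 (boostAt u s y j).1))
              (boostAt u s y i).2 (boostAt u s y j).2
              (‖‖-((boostAt u s y i).2 - (boostAt u s y j).2)‖⁻¹ • (-((boostAt u s y i).2 - (boostAt u s y j).2)) +
                    ‖ξ‖⁻¹ • ξ‖⁻¹ •
                (‖-((boostAt u s y i).2 - (boostAt u s y j).2)‖⁻¹ • (-((boostAt u s y i).2 - (boostAt u s y j).2)) +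
                  ‖ξ‖⁻¹ • ξ)) ∂(stdGaussian V3))
      else 0) =
      (if i < j ∧ y ∈ contactSet (Torus.geometry (Fin 3)) (N + 1) e i j ∧ IsIncoming (Torus.geometry (Fin 3)) y i j then
        ‖(y i).2 - (y j).2‖ ^ 2 *
          ((fun (N : ℕ) (s : ℝ) (x : T3) (v w n : V3) =>
                ψ N s (x + FunctionSpaces.Torus.proj (s • u)) (v + u) (w + u) n) N s
              ((Torus.geometry (Fin 3)).translate (y j).1 ((2 : ℝ)⁻¹ • (Torus.geometry (Fin 3)).sepVec (y i).1 (y j).1))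
              (y i).2 (y j).2 (e⁻¹ • (Torus.geometry (Fin 3)).sepVec (y i).1 (y j).1) -
            ∫ ξ, (fun (N : ℕ) (s : ℝ) (x : T3) (v w n : V3) =>
                ψ N s (x + FunctionSpaces.Torus.proj (s • u)) (v + u) (w + u) n) N s
              ((Torus.geometry (Fin 3)).translate (y j).1 ((2 : ℝ)⁻¹ • (Torus.geometry (Fin 3)).sepVec (y i).1 (y j).1))
              (y i).2 (y j).2
              (‖‖-((y i).2 - (y j).2)‖⁻¹ • (-((y i).2 - (y j).2)) + ‖ξ‖⁻¹ • ξ‖⁻¹ •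
                (‖-((y i).2 - (y j).2)‖⁻¹ • (-((y i).2 - (y j).2)) + ‖ξ‖⁻¹ • ξ)) ∂(stdGaussian V3))
      else 0) := by
  rw [xmid_boostAt]
  simp only [vel_sub_vel_boostAt, sepVec_boostAt, boostAt_mem_contactSet_iff, isIncoming_boostAt_iff]
  simp only [boostAt_apply_snd]

/-- `cruxSummand_boostAt` with the boosted configuration and the instant given by equations (the form consumed
under the collision sum, where the pre-collisional configuration of the boosted datum is only PROVABLY the
boost of that of the datum). [folklore] -/
theorem cruxSummand_congr {N : ℕ} (ψ : ℕ → ℝ → T3 → V3 → V3 → V3 → ℝ) (u : V3) (e : ℝ) {s s' : ℝ}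
    {y y' : Config (N + 1) (Fin 3) T3} (hy : y' = boostAt u s y) (hs : s' = s) (i j : Fin (N + 1)) :
    (if i < j ∧ y' ∈ contactSet (Torus.geometry (Fin 3)) (N + 1) e i j ∧
          IsIncoming (Torus.geometry (Fin 3)) y' i j then
        ‖(y' i).2 - (y' j).2‖ ^ 2 *
          (ψ N s' ((Torus.geometry (Fin 3)).translate (y' j).1
                ((2 : ℝ)⁻¹ • (Torus.geometry (Fin 3)).sepVec (y' i).1 (y' j).1))
              (y' i).2 (y' j).2
              (e⁻¹ • (Torus.geometry (Fin 3)).sepVec (y' i).1 (y' j).1) -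
            ∫ ξ, ψ N s' ((Torus.geometry (Fin 3)).translate (y' j).1
                ((2 : ℝ)⁻¹ • (Torus.geometry (Fin 3)).sepVec (y' i).1 (y' j).1))
              (y' i).2 (y' j).2
              (‖‖-((y' i).2 - (y' j).2)‖⁻¹ • (-((y' i).2 - (y' j).2)) + ‖ξ‖⁻¹ • ξ‖⁻¹ •
                (‖-((y' i).2 - (y' j).2)‖⁻¹ • (-((y' i).2 - (y' j).2)) + ‖ξ‖⁻¹ • ξ)) ∂(stdGaussian V3))
      else 0) =
      (if i < j ∧ y ∈ contactSet (Torus.geometry (Fin 3)) (N + 1) e i j ∧ IsIncoming (Torus.geometry (Fin 3)) y i j then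
        ‖(y i).2 - (y j).2‖ ^ 2 *
          ((fun (N : ℕ) (s : ℝ) (x : T3) (v w n : V3) =>
                ψ N s (x + FunctionSpaces.Torus.proj (s • u)) (v + u) (w + u) n) N s
              ((Torus.geometry (Fin 3)).translate (y j).1 ((2 : ℝ)⁻¹ • (Torus.geometry (Fin 3)).sepVec (y i).1 (y j).1))
              (y i).2 (y j).2 (e⁻¹ • (Torus.geometry (Fin 3)).sepVec (y i).1 (y j).1) -
            ∫ ξ, (fun (N : ℕ) (s : ℝ) (x : T3) (v w n : V3) =>
                ψ N s (x + FunctionSpaces.Torus.proj (s • u)) (v + u) (w + u) n) N s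
              ((Torus.geometry (Fin 3)).translate (y j).1 ((2 : ℝ)⁻¹ • (Torus.geometry (Fin 3)).sepVec (y i).1 (y j).1))
              (y i).2 (y j).2
              (‖‖-((y i).2 - (y j).2)‖⁻¹ • (-((y i).2 - (y j).2)) + ‖ξ‖⁻¹ • ξ‖⁻¹ •
                (‖-((y i).2 - (y j).2)‖⁻¹ • (-((y i).2 - (y j).2)) + ‖ξ‖⁻¹ • ξ)) ∂(stdGaussian V3))
      else 0) := by
  subst hy hs
  exact cruxSummand_boostAt ψ u e s' y i j

/-- **The pre-collisional configuration of a counted collision of the boosted datum** is the boost, AT THE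
COLLISION INSTANT, of the pre-collisional configuration of the datum: for `m < collisionCount z t`,
`S_{τ(z'_m)} z'_m = boostAt u (t_{m+1}) (S_{τ(z_m)} z_m)` with `z' = boostAt u 0 z` (the instant is finite,
`collisionInstant_succ_le_of_mem_range`, so the accumulated real exit times equal `(t_{m+1}).toReal`,
`exitSum_eq_toReal_collisionInstant`). [folklore] -/
theorem zpre_boostAt_zero {N : ℕ} (u : V3) (e : ℝ) {t : ℝ} (z : Config N (Fin 3) T3) {m : ℕ}
    (hm : m ∈ Finset.range (Alexander.collisionCount (Torus.geometry (Fin 3)) e z t)) :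
    freeFlight (Torus.geometry (Fin 3))
        (Alexander.freeExitTime (Torus.geometry (Fin 3)) e
            (Alexander.stateAfter (Torus.geometry (Fin 3)) e (boostAt u 0 z) m)).toReal
        (Alexander.stateAfter (Torus.geometry (Fin 3)) e (boostAt u 0 z) m) =
      boostAt u (Alexander.collisionInstant (Torus.geometry (Fin 3)) e z (m + 1)).toReal
        (freeFlight (Torus.geometry (Fin 3))
          (Alexander.freeExitTime (Torus.geometry (Fin 3)) e
              (Alexander.stateAfter (Torus.geometry (Fin 3)) e z m)).toReal
          (Alexander.stateAfter (Torus.geometry (Fin 3)) e z m)) := by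
  have hfin : Alexander.collisionInstant (Torus.geometry (Fin 3)) e z (m + 1) ≠ ∞ :=
    ne_top_of_le_ne_top ENNReal.ofReal_ne_top (collisionInstant_succ_le_of_mem_range e hm)
  rw [stateAfter_boostAt, freeExitTime_boostAt, freeFlight_boostAt, zero_add, ← Finset.sum_range_succ,
    exitSum_eq_toReal_collisionInstant e hfin]

/-- **GALILEAN COVARIANCE OF THE CRUX FUNCTIONAL** (registered stub `stub_cruxFunctionalVelShift` of line
`Sketch` v7): in the crux's own `let` vocabulary, the normalised `|g|²`-weighted collision sum `D[ψ]` of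
`κ_g`-centred marks of `ψ`, read on the velocity-translated datum `velShift u z`, equals `D[ψ^u]` read on `z`, with
the boosted test function `ψ^u(s, x, v, w, n) = ψ(s, x + s u, v + u, w + u, n)`: the collision count and the
instants are boost-invariant (`collisionCount_boostAt`, `collisionInstant_boostAt`), the `m`-th pre-collisional
configuration of the boosted datum is the boost at the instant `t_{m+1}` of that of the datum
(`zpre_boostAt_zero`), and each summand is covariant (`cruxSummand_boostAt`). [folklore] -/
theorem cruxFunctional_velShift :
    let Cfg : ℕ → Type := fun N => Config (N + 1) (Fin 3) T3
    let G := Torus.geometry (Fin 3)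
    let ε : ℝ → ℕ → ℝ := hsDiameter
    let τ : ℝ → (N : ℕ) → Cfg N → ℝ≥0∞ := fun σ N z => Alexander.freeExitTime G (ε σ N) z
    let S : ℝ → (N : ℕ) → Cfg N → Cfg N := fun t _ z => freeFlight G t z
    let ldir : V3 → V3 → V3 := fun ω ξ => ‖‖ω‖⁻¹ • ω + ‖ξ‖⁻¹ • ξ‖⁻¹ • (‖ω‖⁻¹ • ω + ‖ξ‖⁻¹ • ξ)
    let zpre : ℝ → (N : ℕ) → Cfg N → ℕ → Cfg N := fun σ N z m =>
      let y := Alexander.stateAfter G (ε σ N) z m; S (τ σ N y).toReal N y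
    let Kt : ℝ → (N : ℕ) → Cfg N → ℝ → ℕ := fun σ N z t => Alexander.collisionCount G (ε σ N) z t
    let hit : ℝ → (N : ℕ) → Cfg N → Fin (N + 1) → Fin (N + 1) → Prop := fun σ N y i j =>
      i < j ∧ y ∈ contactSet G (N + 1) (ε σ N) i j ∧ IsIncoming G y i j
    let tcol : ℝ → (N : ℕ) → Cfg N → ℕ → ℝ := fun σ N z m =>
      (Alexander.collisionInstant G (ε σ N) z (m + 1)).toReal
    let xmid : (N : ℕ) → Cfg N → Fin (N + 1) → Fin (N + 1) → T3 := fun _ y i j =>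
      G.translate (y j).1 ((2 : ℝ)⁻¹ • G.sepVec (y i).1 (y j).1)
    let D : (ℕ → ℝ → T3 → V3 → V3 → V3 → ℝ) → ℝ → (N : ℕ) → ℝ → Cfg N → ℝ := fun ψ σ N t z =>
      ((N : ℝ) + 1) ^ (-(4 / 3 : ℝ)) *
        ∑ m ∈ Finset.range (Kt σ N z t), ∑ i : Fin (N + 1), ∑ j : Fin (N + 1),
          (let y := zpre σ N z m
           if hit σ N y i j then
             ‖(y i).2 - (y j).2‖ ^ 2 *
               (ψ N (tcol σ N z m) (xmid N y i j) (y i).2 (y j).2 ((ε σ N)⁻¹ • G.sepVec (y i).1 (y j).1) -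
                 ∫ ξ, ψ N (tcol σ N z m) (xmid N y i j) (y i).2 (y j).2 (ldir (-((y i).2 - (y j).2)) ξ)
                   ∂(stdGaussian V3))
           else 0)
    ∀ (ψ : ℕ → ℝ → T3 → V3 → V3 → V3 → ℝ) (u : V3) (σ : ℝ) (N : ℕ) (t : ℝ) (z : Cfg N),
      D ψ σ N t (velShift u z) =
        D (fun N s x v w n => ψ N s (x + Literature.Analysis.FunctionSpaces.Torus.proj (s • u)) (v + u) (w + u) n)
          σ N t z := by
  dsimp only
  intro ψ u σ N t z
  rw [velShift_eq_boostAt, collisionCount_boostAt]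
  refine congrArg₂ (· * ·) rfl ?_
  refine Finset.sum_congr rfl fun m hm => Finset.sum_congr rfl fun i _ => Finset.sum_congr rfl fun j _ => ?_
  exact cruxSummand_congr ψ u (hsDiameter σ N) (zpre_boostAt_zero u (hsDiameter σ N) z hm)
    (congrArg ENNReal.toReal (collisionInstant_boostAt (hsDiameter σ N) u 0 z (m + 1))) i j

end Summit.AtomisticToContinuum.HydrodynamicLimit.Theorems.ContactAngleEquidistributionSketch

end
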